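import Summits.AtomisticToContinuum.HydrodynamicLimit.Theorems.CellForecastPressureDecay.Negative.PerParticle

/-!
# `CellForecastPressureDecay`: the innermost tilt cap `|c| ≤ 1` is load-bearing

Negative knowledge for the crux `AntiMazurCoboundaries.CellForecastPressureDecay`
(stmt-AtomisticToContinuum-13915), from `Cruxes/CellForecastPressureDecay/Disproof.lean` § 8
(seat refuter-cdisprove-stmt-AtomisticToContinuum-13915-g2-0, cycle 2):

* `CellForecastPressureDecayAllTilts` — the crux VERBATIM with the hypothesis `|c| ≤ 1` dropped — is
  FALSE (`cellForecastPressureDecay_false_allTilts`). Since `c` is the LAST quantifier (after `L`), the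
  lone-particle model `n = 1` (`Negative/LoneParticle.lean`: the functional is `∫ e^{2cg} dγ` at every
  horizon) with `g = κ sin v₀ sin v₁` and the tilt `c = (L³ + 1 − log γ{g > κ/2})/κ` gives, by Chebyshev,
  `∫ e^{2cg} dγ ≥ e^{cκ} γ{g > κ/2} = e^{L³+1} > e^{L³}`.
  Moral for provers: the uniformity in `c ∈ [-1, 1]` is a compactness clause; the effective amplitude is
  `|c|κ` and any proof uses `|c| ≤ 1` quantitatively.
-/

open MeasureTheory Set Metric Filter ProbabilityTheory
open scoped ENNReal InnerProductSpace
open Literature.Analysis.FluidPDE Literature.MathematicalPhysics.KineticTheory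
open Literature.Analysis.UnboundedOperators (isOpenPosMeasure_stdGaussian)

namespace Summit.AtomisticToContinuum.HydrodynamicLimit.Theorems

noncomputable section

namespace CellForecastPressureDecay

/-! ## § 8 The innermost tilt cap `|c| ≤ 1` is load-bearing (`c` is quantified after `L`) -/

/-- `CellForecastPressureDecay` with the tilt cap `|c| ≤ 1` DROPPED (all real `c`; everything else
verbatim). Since `c` is the innermost quantifier (after `L`), this is uniformity in the tilt. -/
def CellForecastPressureDecayAllTilts : Prop :=
  ∃ σ₀ : ℝ, 0 < σ₀ ∧ ∀ σ : ℝ, 0 < σ → σ < σ₀ → ∃ κ : ℝ, 0 < κ ∧ ∀ g : Literature.MathematicalPhysics.KineticTheory.V3 → ℝ, Continuous g → (∀ v, |g v| ≤ κ) → (∀ (c₀ c₂ : ℝ) (b : Literature.MathematicalPhysics.KineticTheory.V3), ∫ v, g v * (c₀ + inner ℝ b v + c₂ * ‖v‖ ^ 2) ∂(ProbabilityTheory.stdGaussian Literature.MathematicalPhysics.KineticTheory.V3) = 0) → ∀ δ : ℝ, 0 < δ → ∃ T : ℝ, 0 < T ∧ ∃ R₀ : ℝ, 0 < R₀ ∧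 ∀ R : ℝ, R₀ ≤ R → ∃ L₀ : ℝ, 0 < L₀ ∧ ∀ L : ℝ, L₀ ≤ L → ∀ n : ℕ, (n : ℝ) ≤ 2 * L ^ 3 → ∀ (Ψ : (k : ℕ) → Literature.Analysis.FluidPDE.HardSphereFlow (Literature.Analysis.FluidPDE.Euclidean.geometry (Fin 3)) σ k) (c : ℝ), ∫⁻ z, ENNReal.ofReal (Real.exp (2 * c * ∑ i : Fin n, T⁻¹ * ∫ t in (0 : ℝ)..T, g (Literature.Analysis.FluidPDE.localClusterState Ψ R t z i).2)) ∂(Literature.Analysis.FluidPDE.particleLaw (Ψ n) (Literature.Analysis.FluidPDE.canonicalDensity (Literature.Analysis.FluidPDE.Euclidean.geometry (Fin 3)) σ n (fun p => Set.indicator {x : Literature.MathematicalPhysics.KineticTheory.V3 | ∀ k, x k ∈ Set.Icc (0 : ℝ) L} (fun _ => (1 : ℝ)) p.1 * Literature.Analysis.FluidPDE.globalMaxwellian p.2))) ≤ ENNReal.ofReal (Real.exp (δ * L ^ 3))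

/-- Sanity: the all-tilts variant is the crux with one hypothesis fewer (so it implies the crux). [folklore] -/
theorem cellForecastPressureDecay_of_allTilts (h : CellForecastPressureDecayAllTilts) :
    Summit.AtomisticToContinuum.HydrodynamicLimit.Theses.AntiMazurCoboundaries.CellForecastPressureDecay := by
  obtain ⟨σ₀, hσ₀, h⟩ := h
  refine ⟨σ₀, hσ₀, fun σ hσ hσ' => ?_⟩
  obtain ⟨κ, hκ, h⟩ := h σ hσ hσ'
  refine ⟨κ, hκ, fun g hg hgb horth δ hδ => ?_⟩
  obtain ⟨T, hT, R₀, hR₀, h⟩ := h g hg hgb horth δ hδ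
  refine ⟨T, hT, R₀, hR₀, fun R hR => ?_⟩
  obtain ⟨L₀, hL₀, h⟩ := h R hR
  exact ⟨L₀, hL₀, fun L hL n hn Ψ c _ => h L hL n hn Ψ c⟩

/-- **The tilt cap is load-bearing**: with `∀ c : ℝ` in place of `∀ |c| ≤ 1` the statement is false.
Witness: `n = 1` (a lone particle flies freely, the functional is `∫ e^{2cg} dγ` at every horizon),
`g = κ sin v₀ sin v₁`, and — `c` being chosen AFTER `L` — the tilt `c = (L³ + 1 − log γ{g > κ/2})/κ`:
Chebyshev gives `∫ e^{2cg} dγ ≥ e^{cκ} γ{g > κ/2} > e^{L³}`. So any proof uses `|c| ≤ 1`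
quantitatively (equivalently: the amplitude that matters is `|c|κ`). [folklore] -/
theorem cellForecastPressureDecay_false_allTilts : ¬ CellForecastPressureDecayAllTilts := by
  rintro ⟨σ₀, hσ₀, h⟩
  set σ : ℝ := σ₀ / 2 with hσdef
  have hσpos : 0 < σ := by positivity
  obtain ⟨κ, hκ, h⟩ := h σ hσpos (by linarith)
  obtain ⟨T, hT, R₀, hR₀, h⟩ :=
    h (gW κ) (continuous_gW κ) (abs_gW_le hκ.le) (gW_orthogonal κ) 1 one_pos
  obtain ⟨L₀, hL₀, h⟩ := h R₀ le_rfl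
  set L : ℝ := max L₀ 1 with hLdef
  have hL1 : 1 ≤ L := le_max_right _ _
  set Ψ : (k : ℕ) → HardSphereFlow (Euclidean.geometry (Fin 3)) σ k :=
    fun k => (HardSphereFlow.nonempty_holds hσpos k).some with hΨ
  -- the set where `g > κ/2` has positive Gaussian measure
  haveI := isOpenPosMeasure_stdGaussian (E := V3)
  set S : Set V3 := {v | κ / 2 < gW κ v} with hSdef
  have hSo : IsOpen S := isOpen_lt continuous_const (continuous_gW κ)
  set vstar : V3 := WithLp.toLp 2 ![Real.pi / 2, Real.pi / 2, 0] with hvstar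
  have hgstar : gW κ vstar = κ := by
    simp [gW, hvstar, Real.sin_pi_div_two]
  have hSne : S.Nonempty := ⟨vstar, by simp only [hSdef, mem_setOf_eq, hgstar]; linarith⟩
  set p : ℝ := (stdGaussian V3).real S with hpdef
  have hp : 0 < p := by
    rw [hpdef, Measure.real, ENNReal.toReal_pos_iff]
    exact ⟨hSo.measure_pos _ hSne, measure_lt_top _ _⟩
  have hlogp : Real.log p ≤ 0 := Real.log_nonpos hp.le (by
    rw [hpdef]; exact measureReal_le_one)  -- probability measure
  -- the tilt, chosen after `L`
  set c : ℝ := (L ^ 3 + 1 - Real.log p) / κ with hcdef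
  have hL3 : (1 : ℝ) ≤ L ^ 3 := one_le_pow₀ hL1
  have hc0 : 0 ≤ c := by
    rw [hcdef]
    exact div_nonneg (by linarith) hκ.le
  have hcκ : c * κ = L ^ 3 + 1 - Real.log p := by
    rw [hcdef, div_mul_cancel₀ _ hκ.ne']
  have key := h L (le_max_left _ _) 1 (by norm_num; linarith) Ψ c
  simp_rw [windowAverage_one Ψ R₀ hT.ne' (gW κ) c] at key
  have hFc : Continuous fun v : V3 => Real.exp (2 * c * gW κ v) :=
    (continuous_const.mul (continuous_gW κ)).rexp
  have hbound : ∀ v, Real.exp (2 * c * gW κ v) ≤ Real.exp (2 * c * κ) := by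
    intro v
    refine Real.exp_le_exp.2 ?_
    have := abs_gW_le hκ.le v
    rw [abs_le] at this
    nlinarith [this.2]
  rw [← cellRef_eq, lintegral_cellLaw_one σ (by linarith) (Ψ 1)
      (F := fun v => Real.exp (2 * c * gW κ v)) hFc.measurable (fun v => (Real.exp_pos _).le) ?_] at key
  · rw [← integral_stdGaussian_eq_integral_mul_globalMaxwellian,
      ENNReal.ofReal_le_ofReal_iff (by positivity)] at key
    simp only [one_mul] at key
    -- key : ∫ exp (2c g) dγ ≤ exp (L ^ 3)
    have hInt : Integrable (fun v => Real.exp (2 * c * gW κ v)) (stdGaussian V3) :=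
      (integrable_const (Real.exp (2 * c * κ))).mono' hFc.aestronglyMeasurable
        (Eventually.of_forall fun v => by
          rw [Real.norm_eq_abs, abs_of_pos (Real.exp_pos _)]; exact hbound v)
    have hcheb := mul_meas_ge_le_integral_of_nonneg
      (Eventually.of_forall fun v => (Real.exp_pos (2 * c * gW κ v)).le) hInt (Real.exp (c * κ))
    have hsub : S ⊆ {v | Real.exp (c * κ) ≤ Real.exp (2 * c * gW κ v)} := by
      intro v hv
      simp only [hSdef, mem_setOf_eq] at hv ⊢
      refine Real.exp_le_exp.2 ?_
      nlinarith
    have hmono : p ≤ (stdGaussian V3).real {v | Real.exp (c * κ) ≤ Real.exp (2 * c * gW κ v)} :=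
      measureReal_mono hsub
    have hlow : Real.exp (c * κ) * p ≤ Real.exp (L ^ 3) :=
      le_trans (le_trans (mul_le_mul_of_nonneg_left hmono (Real.exp_pos _).le) hcheb) key
    -- but exp(cκ) p = exp(L³ + 1 - log p) p = exp(L³+1) > exp(L³)
    have hexp : Real.exp (c * κ) * p = Real.exp (L ^ 3 + 1) := by
      rw [hcκ, sub_eq_add_neg, Real.exp_add, Real.exp_neg, Real.exp_log hp]
      field_simp
    rw [hexp] at hlow
    have := Real.exp_lt_exp.2 (by linarith : L ^ 3 < L ^ 3 + 1)
    linarith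
  · -- integrability of M · e^{2cg}
    refine integrable_globalMaxwellian.mul_bdd (c := Real.exp (2 * c * κ)) hFc.aestronglyMeasurable
      (Eventually.of_forall fun v => ?_)
    rw [Real.norm_eq_abs, abs_of_pos (Real.exp_pos _)]
    exact hbound v



end CellForecastPressureDecay

end

end Summit.AtomisticToContinuum.HydrodynamicLimit.Theorems
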